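import Literature.MathematicalPhysics.QuantumFieldTheory.Balaban1983to89.B9Eq326ConjugatedDeltaATower
import Literature.MathematicalPhysics.QuantumFieldTheory.Balaban1983to89.B9Eq326ConjugatedDeltaATwoBackgrounds

/-!
# `Balaban1983to89.B9Eq326ConjugatedDeltaATowerTwoBackgrounds` — T. Bałaban, *Propagators for lattice gauge theories in a background field*, Commun. Math.
# Phys. **99** (1985) 389–434 [Balaban1985BackgroundPropagators] (3.26) p. 395 (with (3.16)∕(3.24) pp. 393–394: the `k`-level operators), (3.21)∕(3.25) p. 394,
# (3.49) p. 399, (3.52)–(3.53) and Thm 3.4 p. 400, (3.84)–(3.86) p. 407, Thm 3.11 p. 416 with [Balaban1985Variational] (110) p. 294: **THE TWO-BACKGROUND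
# DIFFERENCE OF THE CONJUGATED `k`-LEVEL BOND PROPAGATOR — `‖e^{κχ}·(G₁,k(V) − G₁,k(U))·e^{−κχ}‖ ≤ (Θ∕γ′)·((1 + δ_N)γ′⁻¹)` WITH `Θ` LINEAR IN THE
# TWO-BACKGROUND LETTERS, EVERY HEIGHT, NO `η`, NO VOLUME** — the two-background twin of (CDT) `B9Eq326ConjugatedDeltaATower.norm_conjG1k_le` (`‖e^{κχ}G₁,k(U)e^{−κχ}‖
# ≤ 4∕γ`): (CDT)'s letters AT `U` AND AT `V` composed with this lineage's abstract END `B9Eq326ConjugatedDeltaATwoBackgrounds.norm_conjGk_sub_conjGk_le` (road (α) of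
# t4-ne9-idea-1 gen 151's N52 «the two-background difference of the bond propagator WITH decay», the LATTICE junction modulo the displayed difference letters)

statement-level skeleton of published theorems with citation tags; proofs where landed; nothing here is a claim about the Yang–Mills mass gap

CITATION HEADER (lean-in-tree rule).  Audit cell `pub-balaban`, sub-cell `t4`, BINDER row NE9; filed by NE9 formalisation-swarm LEAF PROVER 01
(`b2b-balaban-t4-ne9-formalise-leaf-01`, gen 88) under the fallback offer O-leaf01-g88-2 (cell journal 2026-08-25).  Imports ne9-leaf-03's (CDT)
`B9Eq326ConjugatedDeltaATower` (gen 75: `deltaAk_structure`, `conjDeltaAk_apply`, `conjDeltaAk_conjInv`, `re_inner_RofUk_eq`, `norm_RofUk_le`, `conj_inv_eta'`; its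
proof text for the discharge of the curl ∕ cocurl ∕ divergence ∕ gradient conjugation letters is re-used here verbatim, parametrised over the background — CREDIT
ne9-leaf-03 g75 and t4-ne9-p1 g92's (D0-c) pattern) and this lineage's `B9Eq326ConjugatedDeltaATwoBackgrounds` (the END).  Sources READ first-hand in the held
text layer (`paper:balaban1985-cmp99-background-propagators`, journal page = PDF page + 388): p. 395 (3.26), pp. 393–394 (3.16)∕(3.24), p. 394 (3.21)∕(3.25), p. 399
(3.49), p. 400 (3.52)–(3.53) *«Δ_{U′U} = Δ_U − V₁(A)»* and Thm 3.4 *«the operators G′(U), (Q′(U)G′²(U)Q′*(U))⁻¹, R(U), G(U) extend to configurations U′U … as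
analytic functions of A … describing these analytic extensions as small perturbations of the operators depending on U only»*, p. 407 (3.86) *«G(U′U) =
G(U)(I − V(A)G(U))⁻¹»*, p. 416 Thm 3.11 *«the operators … Δ_a, G are positive, uniformly bounded from below … the kernels … decay exponentially»*;
[Balaban1985Variational] p. 294 (110).  Print's perturbation in the background is the Neumann series (3.86) and its decay proof is the random walk of Sect. C;
the conjugation `e^{κχ}(·)e^{−κχ}` and the energy-norm perturbation argument are the ROUTE's substitutes (`t4/ROUTES-NE9.md` §L1.2 R2′ road B8″, §L1.4 EXAMINED
gen 151 N52); nothing of print's rate or radius is asserted.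

WHY THIS FILE (N52 road (α), the lattice junction modulo letters).  (CDT) gives `‖S∘G₁,k(U)∘S⁻¹‖ ≤ 4∕γ` (ONE background, decay after the read-out
`B9Eq349BondBlockDecayFromCircle`); ne9-leaf-04's `B9Eq386GreenkLipschitzEnergy(Pi)TwoBackgrounds` give `G₁,k(U) − G₁,k(V)` in the energy currency WITHOUT
decay.  Here the two are joined at the lattice: `S∘G₁,k(X)∘S⁻¹` is a right inverse of `S∘Δ_{a,k}(X)∘S⁻¹` ((CDT) `conjDeltaAk_conjInv`), whose conjugated
structure is (CDT) `conjDeltaAk_apply`, and the END `…TwoBackgrounds.norm_conjGk_sub_conjGk_le` applies by `exact` once the one-background conjugation letters of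
the curl ∕ cocurl ∕ divergence ∕ gradient are discharged (as in (CDT) §1, for `U` and for `V`).  What stays DISPLAYED: (CDT)'s own displayed letters (twice),
the eight conjugated two-background letters `δ₁, δ₂, δ_R, δ_Q, δ_K` (lattice form: differences of the conjugated `k`-level operators at `V` and at `U`) and the
four unconjugated ZEROTH-order ones `e₁, e₂, e_R, e_Q` (the first-order factor `D*_V` is measured against `N_V` inside the END, never against `‖·‖`).

WHAT IS PROVED (sorry-free; proof lane — no `def`; [folklore] composition BY NAME).
* **`norm_conjG1k_sub_conjG1k_le`** — the display above.
MODEL ∕ HONEST SCOPE.  (M1) the model letters of (CDT) (`𝔸` a normed `*`-algebra, `W ≃ 𝔸` the fibre, `U1` the unit-ball units, uniform weights `c₀, c₁`).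
(M2) DISPLAYED (twice): `γ` (Thm 3.11 at `k` levels, NOT proved in the tree), `p_K`, `β_K`, the `Q_k` letters, `ρ`, `C_P`, positivity of `Δ_{a,k}`; the
two-background letters `δ₁, δ₂, δ_R, δ_Q, δ_K, e₁, e₂, e_R, e_Q` (suppliers: the «conjugate the difference» lemmas for `δ₁, δ₂` — zeroth order, `∝ δ`, no
`η⁻¹`; conjugated `Q_k` ∕ `R_k(U)` ∕ `Δ′` two-background letters for `δ_Q, δ_R, δ_K`; ne9-leaf-04's curl ∕ divergence closeness letters, the `R_k` Lipschitz letter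
(`B9Eq325RLipschitzSqrtTowerTwoBackgroundsLinear`) and ne9-leaf-02's `Q_k`-Lipschitz for the `e`'s — NONE of them in this file).  (M3) FIRST order in `V − U` (road (α)); crude constants.  (M4) no rate, no window evaluated; the read-out to block decay
(`norm_bondBlock_le_exp_of_uniform_circle_bound`, uniformly on `‖κ‖ = r`) is the consumer's line, NOT here.  NOT NE9 (cell pub-balaban: NE9 NOT PRINTED ∕ NOT
PROVED; «NE9 ⇐ the named binders»; row WALLED ON A MODEL (O-NE9-1; #5 UNRULED); spine PROVED 0∕9; rung (B)+1 on a finite T⁴ — NOT infinite volume, NOT mass gap,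
NOT BetaPertH, NOT Clay).  HONEST DEPENDENCY (cell line): continuum YM on T⁴ ⇐ BetaPertH ∧ nine spine estimates (0/9 proved); BetaPertH ⇐ (D1) ∧ (D4) ∧
CAP+tail; G-an2-4 gates asym, D1 and NE2/3/4.  NEW file; nothing modified.  Net new unproved facts: 0.
-/

noncomputable section

open scoped InnerProductSpace ComplexConjugate BigOperators

namespace Literature.MathematicalPhysics.QuantumFieldTheory.Balaban1983to89.B9Eq326ConjugatedDeltaATowerTwoBackgrounds

open B4Sect5Torus (TSite)
open B9SectCLatticeCarrier (Bond bpos btgt)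
open B9Eq311L2Pairing (WL2)
open B7Prop1Explicit (U1)
open B9Eq315QTower (towerP)
open B9Eq315QTorus (perCfg cornerSite)
open B7Prop1Explicit (Wcx boxVec)
open B11Eq103H1Complex (SiteL2K BondL2K covDerivL2K covDivL2K adjoint_covDerivL2K)
open B9Eq310HessianOperator (adTransportW PlaqL2K covCurlL2K covCoCurlL2K curvOp adjoint_covCurlL2K)
open B9Eq3101ConjugationLettersChain (norm_adTransportW_le norm_mulOp_covDerivL2K_adTransportW_sub_le)
open B9Eq3101ConjugationLettersCurl (norm_mulOp_covCurlL2K_sub_le norm_mulOp_covDivL2K_sub_le)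
open B9Eq3101ConjugationLettersCoCurl (norm_mulOp_covCoCurlL2K_sub_le)
open B9Eq326OperatorTower (laplaceAk RofUk G1k QkW)
open B9Eq326ConjugatedDeltaATower (conj_inv_eta' re_inner_RofUk_eq norm_RofUk_le deltaAk_structure conjDeltaAk_apply conjDeltaAk_conjInv)
open B9Eq326ConjugatedDeltaATwoBackgrounds (norm_conjGk_sub_conjGk_le)

variable {d : ℕ} (L : ℕ) [NeZero L] (m : Fin d → ℕ) [∀ i, NeZero (m i)] (n : ℕ)
  {𝔸 : Type*} [NormedRing 𝔸] [StarRing 𝔸] [NormedAlgebra ℂ 𝔸] [StarModule ℂ 𝔸] [CompleteSpace 𝔸] [NormOneClass 𝔸]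
  {W : Type*} [NormedAddCommGroup W] [InnerProductSpace ℂ W] [FiniteDimensional ℂ W] (φ : W ≃ₗ[ℂ] 𝔸) {Mφ Mφ' : ℝ}
  (hφ : ∀ w, ‖φ w‖ ≤ Mφ * ‖w‖) (hφ' : ∀ X, ‖φ.symm X‖ ≤ Mφ' * ‖X‖) (hMφ : 0 ≤ Mφ) (hMφ' : 0 ≤ Mφ')
  {c₀ : ℝ} [Fact (0 < c₀)] {c₁ : ℝ} [Fact (0 < c₁)] {η : ℝ} (hη : 0 < η)
  (U V : Bond d (towerP L m (n + 1)) → 𝔸ˣ) (hU : ∀ b, U b ∈ U1 𝔸) (hV : ∀ b, V b ∈ U1 𝔸)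
  (hRSU : ∀ (b : Bond d (towerP L m (n + 1))) (v u : W), ⟪adTransportW φ U b v, u⟫_ℂ = ⟪v, adTransportW φ (fun b => (U b)⁻¹) b u⟫_ℂ)
  (hRSV : ∀ (b : Bond d (towerP L m (n + 1))) (v u : W), ⟪adTransportW φ V b v, u⟫_ℂ = ⟪v, adTransportW φ (fun b => (V b)⁻¹) b u⟫_ℂ)
  (τ : 𝔸 →ₗ[ℂ] ℂ) (hL : 1 ≤ L) (α : ℕ → ℝ) (hα1 : ∀ j, α j ≤ 1 / 64)
  (hU1U : ∀ (j : ℕ) (x : B7Prop1Explicit.Site d) (κ : Fin d), perCfg (towerP L m (j + 1)) (B9Eq315QTower.UlevOf L m (n + 1) U j) x κ ∈ U1 𝔸)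
  (hregU : ∀ (j : ℕ) (y : TSite d (towerP L m j)) (κ : Fin d) (r : Fin d → Fin L),
    ‖((Wcx L (perCfg (towerP L m (j + 1)) (B9Eq315QTower.UlevOf L m (n + 1) U j)) (cornerSite L y) κ (boxVec L r) : 𝔸ˣ) : 𝔸) - 1‖ ≤ α j)
  (hU1V : ∀ (j : ℕ) (x : B7Prop1Explicit.Site d) (κ : Fin d), perCfg (towerP L m (j + 1)) (B9Eq315QTower.UlevOf L m (n + 1) V j) x κ ∈ U1 𝔸)
  (hregV : ∀ (j : ℕ) (y : TSite d (towerP L m j)) (κ : Fin d) (r : Fin d → Fin L),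
    ‖((Wcx L (perCfg (towerP L m (j + 1)) (B9Eq315QTower.UlevOf L m (n + 1) V j)) (cornerSite L y) κ (boxVec L r) : 𝔸ˣ) : 𝔸) - 1‖ ≤ α j)
  (a : ℝ)
  {κ : ℂ} {χ : TSite d (towerP L m (n + 1)) → ℝ}
  {S Sinv : BondL2K ℂ d (towerP L m (n + 1)) c₀ W →ₗ[ℂ] BondL2K ℂ d (towerP L m (n + 1)) c₀ W}
  (hS : ∀ (g : BondL2K ℂ d (towerP L m (n + 1)) c₀ W) (b : Bond d (towerP L m (n + 1))),
    WL2.equiv ℂ (fun _ : Bond d (towerP L m (n + 1)) => c₀) W (S g) b =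
      Complex.exp (κ * (χ (bpos b) : ℂ)) • WL2.equiv ℂ (fun _ : Bond d (towerP L m (n + 1)) => c₀) W g b)
  (hSinv : ∀ (g : BondL2K ℂ d (towerP L m (n + 1)) c₀ W) (b : Bond d (towerP L m (n + 1))),
    WL2.equiv ℂ (fun _ : Bond d (towerP L m (n + 1)) => c₀) W (Sinv g) b =
      Complex.exp (-(κ * (χ (bpos b) : ℂ))) • WL2.equiv ℂ (fun _ : Bond d (towerP L m (n + 1)) => c₀) W g b)
  {SP SPinv : PlaqL2K ℂ d (towerP L m (n + 1)) c₀ W →ₗ[ℂ] PlaqL2K ℂ d (towerP L m (n + 1)) c₀ W}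
  (hSP : ∀ (g : PlaqL2K ℂ d (towerP L m (n + 1)) c₀ W) (p : B9SectCLatticeCarrier.Plaq d (towerP L m (n + 1))),
    WL2.equiv ℂ (fun _ : B9SectCLatticeCarrier.Plaq d (towerP L m (n + 1)) => c₀) W (SP g) p =
      Complex.exp (κ * (χ p.1 : ℂ)) • WL2.equiv ℂ (fun _ : B9SectCLatticeCarrier.Plaq d (towerP L m (n + 1)) => c₀) W g p)
  (hSPinv : ∀ (g : PlaqL2K ℂ d (towerP L m (n + 1)) c₀ W) (p : B9SectCLatticeCarrier.Plaq d (towerP L m (n + 1))),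
    WL2.equiv ℂ (fun _ : B9SectCLatticeCarrier.Plaq d (towerP L m (n + 1)) => c₀) W (SPinv g) p =
      Complex.exp (-(κ * (χ p.1 : ℂ))) • WL2.equiv ℂ (fun _ : B9SectCLatticeCarrier.Plaq d (towerP L m (n + 1)) => c₀) W g p)
  {SS SSinv : SiteL2K ℂ d (towerP L m (n + 1)) c₀ W →ₗ[ℂ] SiteL2K ℂ d (towerP L m (n + 1)) c₀ W}
  (hSS : ∀ (g : SiteL2K ℂ d (towerP L m (n + 1)) c₀ W) (x : TSite d (towerP L m (n + 1))),
    WL2.equiv ℂ (fun _ : TSite d (towerP L m (n + 1)) => c₀) W (SS g) x =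
      Complex.exp (κ * (χ x : ℂ)) • WL2.equiv ℂ (fun _ : TSite d (towerP L m (n + 1)) => c₀) W g x)
  (hSSinv : ∀ (g : SiteL2K ℂ d (towerP L m (n + 1)) c₀ W) (x : TSite d (towerP L m (n + 1))),
    WL2.equiv ℂ (fun _ : TSite d (towerP L m (n + 1)) => c₀) W (SSinv g) x =
      Complex.exp (-(κ * (χ x : ℂ))) • WL2.equiv ℂ (fun _ : TSite d (towerP L m (n + 1)) => c₀) W g x)

include hφ hφ' hMφ hMφ' hη hU hV hRSU hRSV hS hSinv hSP hSPinv hSS hSSinv in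
/-- **THE TWO-BACKGROUND DIFFERENCE OF THE CONJUGATED `k`-LEVEL BOND PROPAGATOR — (CDT) AT `U` AND AT `V` COMPOSED WITH THE ABSTRACT END.**
On `towerP L m (n+1)`, two backgrounds `U, V` of the MODEL class (`U(b), V(b) ∈ U1`, mutually adjoint transports), the SAME multiplication maps
`S, S⁻¹, S_P, S_P⁻¹, S_S, S_S⁻¹` (weight `χ` with bond increments `≤ ℓη`, `κ` in the windows `‖κ‖ℓη ≤ 1`, `4‖κ‖ℓM_φM_φ′d√d ≤ β`, `4‖κ‖ℓM_φM_φ′d ≤ β`,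
`2‖κ‖ℓM_φM_φ′√d ≤ β`), (CDT)'s displayed letters AT BOTH BACKGROUNDS with ONE set of scalars (`γ`-coercivity of `Δ_{a,k}` — Thm 3.11, displayed;
the `Δ′` floor `p_K`; the conjugated `Q_k`, `Δ′`, `R_k` letters `β, β_K, ρ ≤ 1∕8`; the complementary-projection bound `C_P`) on the ENERGY window
`¾p_K + (21 + 3a)β² + 4βC_P + 2ρC_P² + β_K ≤ γ∕8`, the eight CONJUGATED two-background letters in lattice form (`δ₁`: curl ∕ cocurl, `δ₂`: divergence ∕
gradient — supplied by the `B9Eq3101ConjugationLetters*`-type «conjugate the difference» lemmas, NOT here; `δ_R`, `δ_Q`, `δ_K` displayed) and the four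
UNconjugated ZEROTH-order ones (`e₁`: curl closeness, `e₂`: divergence closeness, `e_R`: the `R_k` Lipschitz letter, `e_Q`: `Q_k` Lipschitz — ne9-leaf-04's ∕
ne9-leaf-02's letters, displayed) ⟹ `‖(S∘G₁,k(V)∘S⁻¹)y − (S∘G₁,k(U)∘S⁻¹)y‖ ≤ (Θ∕γ′)·((1 + δ_N)γ′⁻¹)·‖y‖`, `γ′ = min(¼, γ∕8)`,
`δ_N = e₁ + e₂ + e_R(1 + C_P) + √a·e_Q`, `Θ` as in
`B9Eq326ConjugatedDeltaATwoBackgrounds.norm_conjGk_sub_conjGk_le` — every height `n`, every `χ`, `κ` of the windows, NO `η`, NO volume.  Proof = (CDT)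
`norm_conjG1k_le`'s discharge of the curl ∕ cocurl ∕ divergence ∕ gradient conjugation letters (twice) + `deltaAk_structure` ∕ `conjDeltaAk_apply` ∕
`conjDeltaAk_conjInv` (twice) + the END by `exact`.  Uniformly on `‖κ‖ = r` this is the `hC` letter of
`B9Eq349BondBlockDecayFromCircle.norm_bondBlock_le_exp_of_uniform_circle_bound` for `T := G₁,k(V) − G₁,k(U)` (t4-ne9-idea-1 g151's N52 road (α)). [folklore]
[cite: Balaban1985BackgroundPropagators, (3.26) p.395, (3.21) p.394, (3.49) p.399, Thm 3.4 p.400, (3.52)–(3.53) p.400, (3.84)–(3.86) p.407, Thm 3.11 p.416; Balaban1985Variational, (110) p.294] -/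
theorem norm_conjG1k_sub_conjG1k_le (ha : 0 ≤ a)
    (hposU : ∀ x : BondL2K ℂ d (towerP L m (n + 1)) c₀ W, x ≠ 0 → 0 < RCLike.re ⟪x, laplaceAk L m n φ η U hL α hα1 hU1U hregU τ (c₀ := c₀) (c₁ := c₁) a x⟫_ℂ)
    (hposV : ∀ x : BondL2K ℂ d (towerP L m (n + 1)) c₀ W, x ≠ 0 → 0 < RCLike.re ⟪x, laplaceAk L m n φ η V hL α hα1 hU1V hregV τ (c₀ := c₀) (c₁ := c₁) a x⟫_ℂ)
    {γ β βK pK ℓ ρ CP : ℝ} (hγ : 0 < γ) (hβ : 0 ≤ β) (hℓ : 0 ≤ ℓ) (hρ : 0 ≤ ρ) (hρ8 : ρ ≤ 1 / 8) (hCP : 0 ≤ CP)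
    (hcoerU : ∀ f : BondL2K ℂ d (towerP L m (n + 1)) c₀ W, γ * ‖f‖ ^ 2 ≤ RCLike.re ⟪f, laplaceAk L m n φ η U hL α hα1 hU1U hregU τ (c₀ := c₀) (c₁ := c₁) a f⟫_ℂ)
    (hcoerV : ∀ f : BondL2K ℂ d (towerP L m (n + 1)) c₀ W, γ * ‖f‖ ^ 2 ≤ RCLike.re ⟪f, laplaceAk L m n φ η V hL α hα1 hU1V hregV τ (c₀ := c₀) (c₁ := c₁) a f⟫_ℂ)
    (hKreU : ∀ f : BondL2K ℂ d (towerP L m (n + 1)) c₀ W, -(pK * ‖f‖ ^ 2) ≤ RCLike.re ⟪f, curvOp φ τ η U f⟫_ℂ)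
    (hKreV : ∀ f : BondL2K ℂ d (towerP L m (n + 1)) c₀ W, -(pK * ‖f‖ ^ 2) ≤ RCLike.re ⟪f, curvOp φ τ η V f⟫_ℂ)
    (hχ : ∀ b : Bond d (towerP L m (n + 1)), |χ (bpos b) - χ (btgt b)| ≤ ℓ * η) (hwin : ‖κ‖ * ℓ * η ≤ 1)
    (hβCC : 4 * ‖κ‖ * ℓ * (Mφ * Mφ') * (d * Real.sqrt d) ≤ β) (hβC : 4 * ‖κ‖ * ℓ * (Mφ * Mφ') * d ≤ β)
    (hβD : 2 * ‖κ‖ * ℓ * (Mφ * Mφ') * Real.sqrt d ≤ β)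
    (QkU QkV : BondL2K ℂ d (towerP L m (n + 1)) c₀ W →ₗ[ℂ] BondL2K ℂ d m c₁ W) (QkU' QkV' : BondL2K ℂ d m c₁ W →ₗ[ℂ] BondL2K ℂ d (towerP L m (n + 1)) c₀ W)
    (hQfacU : ∀ f, S (LinearMap.adjoint (QkW L m n φ U hL α hα1 hU1U hregU (c₀ := c₀) (c₁ := c₁)) (((a : ℝ) : ℂ) • (QkW L m n φ U hL α hα1 hU1U hregU (c₀ := c₀) (c₁ := c₁)) (Sinv f))) = ((a : ℝ) : ℂ) • QkU' (QkU f))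
    (hQfacV : ∀ f, S (LinearMap.adjoint (QkW L m n φ V hL α hα1 hU1V hregV (c₀ := c₀) (c₁ := c₁)) (((a : ℝ) : ℂ) • (QkW L m n φ V hL α hα1 hU1V hregV (c₀ := c₀) (c₁ := c₁)) (Sinv f))) = ((a : ℝ) : ℂ) • QkV' (QkV f))
    (dQU : ∀ f, ‖QkU f - (QkW L m n φ U hL α hα1 hU1U hregU (c₀ := c₀) (c₁ := c₁)) f‖ ≤ β * ‖f‖)
    (dQU' : ∀ g, ‖QkU' g - LinearMap.adjoint (QkW L m n φ U hL α hα1 hU1U hregU (c₀ := c₀) (c₁ := c₁)) g‖ ≤ β * ‖g‖)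
    (dQV : ∀ f, ‖QkV f - (QkW L m n φ V hL α hα1 hU1V hregV (c₀ := c₀) (c₁ := c₁)) f‖ ≤ β * ‖f‖)
    (dQV' : ∀ g, ‖QkV' g - LinearMap.adjoint (QkW L m n φ V hL α hα1 hU1V hregV (c₀ := c₀) (c₁ := c₁)) g‖ ≤ β * ‖g‖)
    (dKU : ∀ f, ‖(S ∘ₗ curvOp φ τ η U ∘ₗ Sinv) f - curvOp φ τ η U f‖ ≤ βK * ‖f‖)
    (dKV : ∀ f, ‖(S ∘ₗ curvOp φ τ η V ∘ₗ Sinv) f - curvOp φ τ η V f‖ ≤ βK * ‖f‖)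
    (dRU : ∀ s, ‖(SS ∘ₗ RofUk L m n φ η U (c₀ := c₀) ∘ₗ SSinv) s - RofUk L m n φ η U (c₀ := c₀) s‖ ≤ ρ * ‖s‖)
    (dRV : ∀ s, ‖(SS ∘ₗ RofUk L m n φ η V (c₀ := c₀) ∘ₗ SSinv) s - RofUk L m n φ η V (c₀ := c₀) s‖ ≤ ρ * ‖s‖)
    (hPU : ∀ f, ‖covDivL2K ℂ c₀ ((η : ℂ))⁻¹ (adTransportW φ fun b => (U b)⁻¹) f -
      RofUk L m n φ η U (c₀ := c₀) (covDivL2K ℂ c₀ ((η : ℂ))⁻¹ (adTransportW φ fun b => (U b)⁻¹) f)‖ ≤ CP * ‖f‖)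
    (hPV : ∀ f, ‖covDivL2K ℂ c₀ ((η : ℂ))⁻¹ (adTransportW φ fun b => (V b)⁻¹) f -
      RofUk L m n φ η V (c₀ := c₀) (covDivL2K ℂ c₀ ((η : ℂ))⁻¹ (adTransportW φ fun b => (V b)⁻¹) f)‖ ≤ CP * ‖f‖)
    (small' : 3 / 4 * pK + (21 + 3 * a) * β ^ 2 + 4 * β * CP + 2 * ρ * CP ^ 2 + βK ≤ γ / 8)
    -- the CONJUGATED two-background letters, lattice form
    {δ₁ δ₂ δR δQ δK : ℝ} (hδ₁ : 0 ≤ δ₁) (hδ₂ : 0 ≤ δ₂) (hδR : 0 ≤ δR) (hδQ : 0 ≤ δQ) (hδK : 0 ≤ δK)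
    (tB₁ : ∀ f, ‖(SP ∘ₗ covCurlL2K ℂ c₀ ((η : ℂ))⁻¹ (adTransportW φ V) ∘ₗ Sinv) f - (SP ∘ₗ covCurlL2K ℂ c₀ ((η : ℂ))⁻¹ (adTransportW φ U) ∘ₗ Sinv) f‖ ≤ δ₁ * ‖f‖)
    (tB₁' : ∀ p, ‖(S ∘ₗ covCoCurlL2K ℂ c₀ ((η : ℂ))⁻¹ (adTransportW φ fun b => (V b)⁻¹) ∘ₗ SPinv) p -
      (S ∘ₗ covCoCurlL2K ℂ c₀ ((η : ℂ))⁻¹ (adTransportW φ fun b => (U b)⁻¹) ∘ₗ SPinv) p‖ ≤ δ₁ * ‖p‖)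
    (tB₂ : ∀ f, ‖(SS ∘ₗ covDivL2K ℂ c₀ ((η : ℂ))⁻¹ (adTransportW φ fun b => (V b)⁻¹) ∘ₗ Sinv) f -
      (SS ∘ₗ covDivL2K ℂ c₀ ((η : ℂ))⁻¹ (adTransportW φ fun b => (U b)⁻¹) ∘ₗ Sinv) f‖ ≤ δ₂ * ‖f‖)
    (tB₂' : ∀ s, ‖(S ∘ₗ covDerivL2K ℂ c₀ ((η : ℂ))⁻¹ (adTransportW φ V) ∘ₗ SSinv) s - (S ∘ₗ covDerivL2K ℂ c₀ ((η : ℂ))⁻¹ (adTransportW φ U) ∘ₗ SSinv) s‖ ≤ δ₂ * ‖s‖)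
    (tR : ∀ s, ‖(SS ∘ₗ RofUk L m n φ η V (c₀ := c₀) ∘ₗ SSinv) s - (SS ∘ₗ RofUk L m n φ η U (c₀ := c₀) ∘ₗ SSinv) s‖ ≤ δR * ‖s‖)
    (tQ : ∀ f, ‖QkV f - QkU f‖ ≤ δQ * ‖f‖) (tQ' : ∀ g, ‖QkV' g - QkU' g‖ ≤ δQ * ‖g‖)
    (tK : ∀ f, ‖(S ∘ₗ curvOp φ τ η V ∘ₗ Sinv) f - (S ∘ₗ curvOp φ τ η U ∘ₗ Sinv) f‖ ≤ δK * ‖f‖)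
    -- the UNconjugated two-background letters (ZEROTH order), lattice form
    {e₁ e₂ eR eQ : ℝ} (he₁ : 0 ≤ e₁) (he₂ : 0 ≤ e₂) (heR : 0 ≤ eR) (heQ : 0 ≤ eQ)
    (uB₁ : ∀ f, ‖covCurlL2K ℂ c₀ ((η : ℂ))⁻¹ (adTransportW φ U) f - covCurlL2K ℂ c₀ ((η : ℂ))⁻¹ (adTransportW φ V) f‖ ≤ e₁ * ‖f‖)
    (uB₂ : ∀ f, ‖covDivL2K ℂ c₀ ((η : ℂ))⁻¹ (adTransportW φ fun b => (U b)⁻¹) f - covDivL2K ℂ c₀ ((η : ℂ))⁻¹ (adTransportW φ fun b => (V b)⁻¹) f‖ ≤ e₂ * ‖f‖)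
    (uR : ∀ s, ‖RofUk L m n φ η U (c₀ := c₀) s - RofUk L m n φ η V (c₀ := c₀) s‖ ≤ eR * ‖s‖)
    (uQ : ∀ f, ‖(QkW L m n φ U hL α hα1 hU1U hregU (c₀ := c₀) (c₁ := c₁)) f - (QkW L m n φ V hL α hα1 hU1V hregV (c₀ := c₀) (c₁ := c₁)) f‖ ≤ eQ * ‖f‖)
    (y : BondL2K ℂ d (towerP L m (n + 1)) c₀ W) :
    ‖(S ∘ₗ G1k L m n φ η V hL α hα1 hU1V hregV τ (c₀ := c₀) (c₁ := c₁) hposV ∘ₗ Sinv) y -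
        (S ∘ₗ G1k L m n φ η U hL α hα1 hU1U hregU τ (c₀ := c₀) (c₁ := c₁) hposU ∘ₗ Sinv) y‖ ≤
      (((1 + β) * δ₁ + δ₁ * (1 + β) + δ₁ * δ₁) +
          ((1 + CP + β) * ((1 + ρ) * δ₂ + δR * (1 + CP + β)) + δ₂ * ((1 + ρ) * (1 + CP + β)) + δ₂ * ((1 + ρ) * δ₂ + δR * (1 + CP + β))) +
          δK + ((Real.sqrt a + |a| * β) * δQ + δQ * (Real.sqrt a + |a| * β) + |a| * (δQ * δQ))) / min (1 / 4) (γ / 8) *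
        ((1 + (e₁ + e₂ + eR * (1 + CP) + Real.sqrt a * eQ)) * (min (1 / 4) (γ / 8))⁻¹) * ‖y‖ := by
  -- transporter bounds `M_T = M_φM_φ′`
  have hRU : ∀ (b : Bond d (towerP L m (n + 1))) (w : W), ‖adTransportW φ U b w‖ ≤ Mφ * Mφ' * ‖w‖ :=
    fun b w => norm_adTransportW_le φ hφ hφ' hMφ' U b (hU b) w
  have hSadU : ∀ (b : Bond d (towerP L m (n + 1))) (w : W), ‖adTransportW φ (fun b => (U b)⁻¹) b w‖ ≤ Mφ * Mφ' * ‖w‖ :=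
    fun b w => norm_adTransportW_le φ hφ hφ' hMφ' (fun b => (U b)⁻¹) b ((U1 𝔸).inv_mem (hU b)) w
  have hRV : ∀ (b : Bond d (towerP L m (n + 1))) (w : W), ‖adTransportW φ V b w‖ ≤ Mφ * Mφ' * ‖w‖ :=
    fun b w => norm_adTransportW_le φ hφ hφ' hMφ' V b (hV b) w
  have hSadV : ∀ (b : Bond d (towerP L m (n + 1))) (w : W), ‖adTransportW φ (fun b => (V b)⁻¹) b w‖ ≤ Mφ * Mφ' * ‖w‖ :=
    fun b w => norm_adTransportW_le φ hφ hφ' hMφ' (fun b => (V b)⁻¹) b ((U1 𝔸).inv_mem (hV b)) w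
  have hMT : 0 ≤ Mφ * Mφ' := mul_nonneg hMφ hMφ'
  have hθ : 0 ≤ ℓ * η := mul_nonneg hℓ hη.le
  have hwin' : ‖κ‖ * (ℓ * η) ≤ 1 := by simpa [mul_assoc] using hwin
  have hcθ : ‖((η : ℂ))⁻¹‖ * (ℓ * η) = ℓ := by
    rw [norm_inv, Complex.norm_real, Real.norm_eq_abs, abs_of_pos hη]; field_simp
  -- the one-background conjugation letters, discharged for a generic `X ∈ {U, V}`
  have dB₁_of : ∀ (X : Bond d (towerP L m (n + 1)) → 𝔸ˣ), (∀ b w, ‖adTransportW φ X b w‖ ≤ Mφ * Mφ' * ‖w‖) →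
      ∀ f, ‖(SP ∘ₗ covCurlL2K ℂ c₀ ((η : ℂ))⁻¹ (adTransportW φ X) ∘ₗ Sinv) f - covCurlL2K ℂ c₀ ((η : ℂ))⁻¹ (adTransportW φ X) f‖ ≤ β * ‖f‖ := by
    intro X hR f
    have h := norm_mulOp_covCurlL2K_sub_le hθ hMT hR hχ hwin' ((η : ℂ))⁻¹ SP hSP Sinv hSinv f
    simp only [LinearMap.comp_apply]
    refine h.trans ?_
    calc 4 * ‖((η : ℂ))⁻¹‖ * ‖κ‖ * (ℓ * η) * (Mφ * Mφ') * d * ‖f‖ = 4 * ‖κ‖ * ℓ * (Mφ * Mφ') * d * ‖f‖ := by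
          rw [show 4 * ‖((η : ℂ))⁻¹‖ * ‖κ‖ * (ℓ * η) = 4 * ‖κ‖ * (‖((η : ℂ))⁻¹‖ * (ℓ * η)) by ring, hcθ]
      _ ≤ β * ‖f‖ := mul_le_mul_of_nonneg_right hβC (norm_nonneg _)
  have dB₁'_of : ∀ (X : Bond d (towerP L m (n + 1)) → 𝔸ˣ),
      (∀ (b : Bond d (towerP L m (n + 1))) (v u : W), ⟪adTransportW φ X b v, u⟫_ℂ = ⟪v, adTransportW φ (fun b => (X b)⁻¹) b u⟫_ℂ) →
      (∀ b w, ‖adTransportW φ (fun b => (X b)⁻¹) b w‖ ≤ Mφ * Mφ' * ‖w‖) →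
      ∀ p, ‖(S ∘ₗ covCoCurlL2K ℂ c₀ ((η : ℂ))⁻¹ (adTransportW φ fun b => (X b)⁻¹) ∘ₗ SPinv) p -
        LinearMap.adjoint (covCurlL2K ℂ c₀ ((η : ℂ))⁻¹ (adTransportW φ X)) p‖ ≤ β * ‖p‖ := by
    intro X hRS hSad p
    rw [adjoint_covCurlL2K _ (conj_inv_eta' η) _ _ hRS]
    have h := norm_mulOp_covCoCurlL2K_sub_le hθ hMT hSad hχ hwin' ((η : ℂ))⁻¹ S hS SPinv hSPinv p
    simp only [LinearMap.comp_apply]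
    refine h.trans ?_
    calc 4 * ‖((η : ℂ))⁻¹‖ * ‖κ‖ * (ℓ * η) * (Mφ * Mφ') * (d * Real.sqrt d) * ‖p‖ = 4 * ‖κ‖ * ℓ * (Mφ * Mφ') * (d * Real.sqrt d) * ‖p‖ := by
          rw [show 4 * ‖((η : ℂ))⁻¹‖ * ‖κ‖ * (ℓ * η) = 4 * ‖κ‖ * (‖((η : ℂ))⁻¹‖ * (ℓ * η)) by ring, hcθ]
      _ ≤ β * ‖p‖ := mul_le_mul_of_nonneg_right hβCC (norm_nonneg _)
  have dB₂_of : ∀ (X : Bond d (towerP L m (n + 1)) → 𝔸ˣ), (∀ b w, ‖adTransportW φ (fun b => (X b)⁻¹) b w‖ ≤ Mφ * Mφ' * ‖w‖) →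
      ∀ f, ‖(SS ∘ₗ covDivL2K ℂ c₀ ((η : ℂ))⁻¹ (adTransportW φ fun b => (X b)⁻¹) ∘ₗ Sinv) f -
        covDivL2K ℂ c₀ ((η : ℂ))⁻¹ (adTransportW φ fun b => (X b)⁻¹) f‖ ≤ β * ‖f‖ := by
    intro X hSad f
    have h := norm_mulOp_covDivL2K_sub_le hθ hMT hSad hχ hwin' ((η : ℂ))⁻¹ SS hSS Sinv hSinv f
    simp only [LinearMap.comp_apply]
    refine h.trans ?_
    calc 2 * ‖((η : ℂ))⁻¹‖ * ‖κ‖ * (ℓ * η) * (Mφ * Mφ') * Real.sqrt d * ‖f‖ = 2 * ‖κ‖ * ℓ * (Mφ * Mφ') * Real.sqrt d * ‖f‖ := by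
          rw [show 2 * ‖((η : ℂ))⁻¹‖ * ‖κ‖ * (ℓ * η) = 2 * ‖κ‖ * (‖((η : ℂ))⁻¹‖ * (ℓ * η)) by ring, hcθ]
      _ ≤ β * ‖f‖ := mul_le_mul_of_nonneg_right hβD (norm_nonneg _)
  have dB₂'_of : ∀ (X : Bond d (towerP L m (n + 1)) → 𝔸ˣ), (∀ b, X b ∈ U1 𝔸) →
      (∀ (b : Bond d (towerP L m (n + 1))) (v u : W), ⟪adTransportW φ X b v, u⟫_ℂ = ⟪v, adTransportW φ (fun b => (X b)⁻¹) b u⟫_ℂ) →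
      ∀ s, ‖(S ∘ₗ covDerivL2K ℂ c₀ ((η : ℂ))⁻¹ (adTransportW φ X) ∘ₗ SSinv) s -
        LinearMap.adjoint (covDivL2K ℂ c₀ ((η : ℂ))⁻¹ (adTransportW φ fun b => (X b)⁻¹)) s‖ ≤ β * ‖s‖ := by
    intro X hX hRS s
    have h2 : LinearMap.adjoint (covDivL2K ℂ c₀ ((η : ℂ))⁻¹ (adTransportW φ fun b => (X b)⁻¹)) =
        covDerivL2K ℂ c₀ ((η : ℂ))⁻¹ (adTransportW φ X) := by
      rw [← adjoint_covDerivL2K ((η : ℂ))⁻¹ (conj_inv_eta' η) _ _ hRS, LinearMap.adjoint_adjoint]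
    rw [h2]
    have h := norm_mulOp_covDerivL2K_adTransportW_sub_le φ hφ hφ' hMφ hMφ' hη hℓ X hX hχ hwin S hS SSinv hSSinv s
    simp only [LinearMap.comp_apply]
    exact h.trans (mul_le_mul_of_nonneg_right hβD (norm_nonneg _))
  -- the structures
  have hRsqU := re_inner_RofUk_eq L m n φ (η := η) (c₀ := c₀) U
  have hR1U := norm_RofUk_le L m n φ (η := η) (c₀ := c₀) U
  have hRsqV := re_inner_RofUk_eq L m n φ (η := η) (c₀ := c₀) V
  have hR1V := norm_RofUk_le L m n φ (η := η) (c₀ := c₀) V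
  have hHU := deltaAk_structure L m n φ (c₀ := c₀) (c₁ := c₁) (η := η) U hRSU τ hL α hα1 hU1U hregU a
  have hHV := deltaAk_structure L m n φ (c₀ := c₀) (c₁ := c₁) (η := η) V hRSV τ hL α hα1 hU1V hregV a
  have hHkU := conjDeltaAk_apply L m n φ (η := η) U hRSU τ hL α hα1 hU1U hregU a (κ := κ) (χ := χ) (S := S) (Sinv := Sinv) hSP hSPinv hSS hSSinv QkU QkU' hQfacU
  have hHkV := conjDeltaAk_apply L m n φ (η := η) V hRSV τ hL α hα1 hU1V hregV a (κ := κ) (χ := χ) (S := S) (Sinv := Sinv) hSP hSPinv hSS hSSinv QkV QkV' hQfacV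
  have hGU := conjDeltaAk_conjInv L m n φ U τ hL α hα1 hU1U hregU a (κ := κ) (χ := χ) hS hSinv hposU
  have hGV := conjDeltaAk_conjInv L m n φ V τ hL α hα1 hU1V hregV a (κ := κ) (χ := χ) hS hSinv hposV
  exact norm_conjGk_sub_conjGk_le ha hγ hβ hρ hρ8 hCP small' hRsqU hR1U hHU hcoerU hKreU hPU (dB₁_of U hRU) (dB₁'_of U hRSU hSadU) (dB₂_of U hSadU)
    (dB₂'_of U hU hRSU) dRU dQU dQU' dKU hHkU hGU hRsqV hR1V hHV hcoerV hKreV hPV (dB₁_of V hRV) (dB₁'_of V hRSV hSadV) (dB₂_of V hSadV)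
    (dB₂'_of V hV hRSV) dRV dQV dQV' dKV hHkV hGV hδ₁ hδ₂ hδR hδQ hδK tB₁ tB₁' tB₂ tB₂' tR tQ tQ' tK he₁ he₂ heR heQ uB₁ uB₂ uR uQ y

end Literature.MathematicalPhysics.QuantumFieldTheory.Balaban1983to89.B9Eq326ConjugatedDeltaATowerTwoBackgrounds

end
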